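import Summits.HodgeConjecture.HodgeConjecture.Theorems.GenericDivisibilityGenericDivisibilityBoundedLevelCleanFunnel
import Summits.HodgeConjecture.HodgeConjecture.Theorems.GenericDivisibilityGenericDivisibilityBoundedSupportedTop
import HarnessLib

/-!
# Route GenericDivisibility — crux C2 `GenericDivisibilityBounded` (stmt-HodgeConjecture-18467):
# the heart of line `finite-level-bootstrap` is only needed OFF the sector `N¹H^{2p} = H^{2p}`

Line `finite-level-bootstrap`, lead c4 (cycle 6). Companion of `…OfOneCleanPrime` (heart ⇒ crux,
p157932), `…OffSmallChow` (c3: heart only needed off the `CH₀`-rank-`≤ 1` sector, p158120) and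
`…SupportedTop` (p160596: the heart at every `(ℓ, s)` and C2 hold at every smooth projective `2p`-fold
with `supportedClasses X (2p) 1 = ⊤`, which contains every sector proved so far). This is the sharpest
consumer of the heart: the crux `GenericDivisibilityBounded` follows from ONE clean prime and level on
every smooth projective complex `2p`-fold (`p ≥ 2`) **carrying a middle class of coniveau `0`**
(`supportedClasses X (2 * p) 1 ≠ ⊤`; granted GHC, `h^{2p,0}(X) ≠ 0`).

* `genericDivisibilityBounded_of_oneCleanPrime_off_supportedTop` — that implication;
* `genericDivisibilityBounded_of_off_supportedTop` — likewise C2 itself only needs proof there;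
* `stub_cruxOfOneCleanPrimeOffSupportedTop` — the registered sub-goal of the crux item, verbatim.

References: [BlochOgus1974ENS] (3.8); [ColliotTheleneVoisin2012] §3.1, §4.1; [GrothendieckTopology1969] §1.
-/

set_option linter.dupNamespace false

noncomputable section

namespace Summit.HodgeConjecture.HodgeConjecture.Theorems

open CategoryTheory AlgebraicGeometry
open Literature.AlgebraicGeometry.Motives Literature.AlgebraicGeometry.HodgeTheory
  Literature.AlgebraicTopology.SingularHomology
open Summit.HodgeConjecture.HodgeConjecture.Theses.GenericDivisibility

/-- **The heart is only needed off the sector `N¹ = ⊤`.** `GenericDivisibilityBounded` follows from the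
existence of one clean prime and level on every smooth projective complex `2p`-fold (`p ≥ 2`) with
`supportedClasses X (2 * p) 1 ≠ ⊤`: on the sector the crux at `X` is
`genericDivisibilityBounded_at_of_supportedClasses_eq_top`, at `p = 1` it is `genericDivisibilityBounded_one`,
and elsewhere one clean level feeds the funnel `genericDivisibilityBounded_at_of_levelClean`.
[cite: ColliotTheleneVoisin2012, §3.1 and §4.1] [cite: GrothendieckTopology1969, §1] -/
theorem genericDivisibilityBounded_of_oneCleanPrime_off_supportedTop
    (hHeart : ∀ ⦃p : ℕ⦄ ⦃X : SchemeOver ℂ⦄, 2 ≤ p → IsSmoothProjective (2 * p) X →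
      supportedClasses X (2 * p) 1 ≠ ⊤ →
      ∃ ℓ s : ℕ, ℓ.Prime ∧ 1 ≤ s ∧
        ∀ z : singularCohomology ℤ ℤ (ComplexPoints X) (2 * p),
          (∃ Z : Set X.left, IsClosed Z ∧ Z ≠ Set.univ ∧
            ∃ (y : singularCohomology ℤ ℤ (complexPointsCompl X Z) (2 * p)) (M : ℕ), 1 ≤ M ∧
              M • (singularCohomology.map ℤ ℤ
                (⟨Subtype.val, continuous_subtype_val⟩ : C(complexPointsCompl X Z, ComplexPoints X))
                (2 * p) z - ℓ ^ s • y) = 0) →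
          ∃ w : singularCohomology ℤ ℤ (ComplexPoints X) (2 * p),
            ∃ Z : Set X.left, IsClosed Z ∧ Z ≠ Set.univ ∧ ∃ N : ℕ, 1 ≤ N ∧
              N • singularCohomology.map ℤ ℤ
                (⟨Subtype.val, continuous_subtype_val⟩ : C(complexPointsCompl X Z, ComplexPoints X))
                (2 * p) (z - ℓ • w) = 0) :
    GenericDivisibilityBounded := by
  intro p X hp hX z hz
  by_cases htop : supportedClasses X (2 * p) 1 = ⊤
  · exact genericDivisibilityBounded_at_of_supportedClasses_eq_top htop z hz
  rcases Nat.lt_or_ge p 2 with hp2 | hp2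
  · obtain rfl : p = 1 := by omega
    exact genericDivisibilityBounded_one hX z hz
  · obtain ⟨ℓ, s, hℓ, hs, hclean⟩ := hHeart hp2 hX htop
    exact genericDivisibilityBounded_at_of_levelClean hX (2 * p) hℓ hs hclean z hz

/-- **C2 itself only needs proof off the sector `N¹ = ⊤`**: if the crux holds at every smooth
projective complex `2p`-fold (`p ≥ 1`) with `supportedClasses X (2 * p) 1 ≠ ⊤`, it holds everywhere.
[cite: GrothendieckTopology1969, §1] -/
theorem genericDivisibilityBounded_of_off_supportedTop
    (h : ∀ ⦃p : ℕ⦄ ⦃X : SchemeOver ℂ⦄, 1 ≤ p → IsSmoothProjective (2 * p) X →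
      supportedClasses X (2 * p) 1 ≠ ⊤ →
      ∀ z : singularCohomology ℤ ℤ (ComplexPoints X) (2 * p),
        (∀ m : ℕ, 1 ≤ m → ∃ Z : Set X.left, IsClosed Z ∧ Z ≠ Set.univ ∧
          ∃ y : singularCohomology ℤ ℤ (complexPointsCompl X Z) (2 * p),
            m • y = singularCohomology.map ℤ ℤ
              (⟨Subtype.val, continuous_subtype_val⟩ : C(complexPointsCompl X Z, ComplexPoints X))
              (2 * p) z) →
        singularCohomology.ringChange (Int.castRingHom ℂ) (ComplexPoints X) (2 * p) z ∈
          supportedClasses X (2 * p) 1) :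
    GenericDivisibilityBounded := by
  intro p X hp hX z hz
  by_cases htop : supportedClasses X (2 * p) 1 = ⊤
  · exact genericDivisibilityBounded_at_of_supportedClasses_eq_top htop z hz
  · exact h hp hX htop z hz

/-- **Registered sub-goal `stub_cruxOfOneCleanPrimeOffSupportedTop` of stmt-HodgeConjecture-18467 (lead
c4)**: the sharpest composition of line `finite-level-bootstrap` as a closed statement — one clean prime
and level on every smooth projective `2p`-fold (`p ≥ 2`) carrying a middle class of coniveau `0`
implies the crux by name. [cite: ColliotTheleneVoisin2012, §3.1 and §4.1] [cite: GrothendieckTopology1969, §1] -/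
theorem stub_cruxOfOneCleanPrimeOffSupportedTop : (∀ ⦃p : ℕ⦄ ⦃X : SchemeOver ℂ⦄, 2 ≤ p → IsSmoothProjective (2 * p) X → supportedClasses X (2 * p) 1 ≠ ⊤ → ∃ ℓ s : ℕ, ℓ.Prime ∧ 1 ≤ s ∧ ∀ z : singularCohomology ℤ ℤ (ComplexPoints X) (2 * p), (∃ Z : Set X.left, IsClosed Z ∧ Z ≠ Set.univ ∧ ∃ (y : singularCohomology ℤ ℤ (complexPointsCompl X Z) (2 * p)) (M : ℕ), 1 ≤ M ∧ M • (singularCohomology.map ℤ ℤ (⟨Subtype.val, continuous_subtype_val⟩ : C(complexPointsCompl X Z, ComplexPoints X)) (2 * p) z - ℓ ^ s • y) = 0) → ∃ w : singularCohomology ℤ ℤ (ComplexPoints X) (2 * p), ∃ Z : Set X.left, IsClosed Z ∧ Z ≠ Set.univ ∧ ∃ N : ℕ, 1 ≤ N ∧ N • singularCohomology.map ℤ ℤ (⟨Subtype.val, continuous_subtype_val⟩ : C(complexPointsCompl X Z, ComplexPoints X)) (2 * p) (z - ℓ • w) = 0) → Summit.HodgeConjecture.HodgeConjecture.Theses.GenericDivisibility.GenericDivisibilityBounded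 :=
  fun hHeart ↦ genericDivisibilityBounded_of_oneCleanPrime_off_supportedTop hHeart

end Summit.HodgeConjecture.HodgeConjecture.Theorems

end
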